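import Literature.MathematicalPhysics.QuantumFieldTheory.Balaban1983to89.B6DomainMajorant
import Literature.MathematicalPhysics.QuantumFieldTheory.Balaban1983to89.B6RandomWalkHom

/-!
# `Balaban1983to89.B6MajorantTransferSteps` — T. Bałaban, *Propagators and renormalization transformations for lattice gauge theories. II*,
# Commun. Math. Phys. **96** (1984) 223–250 [Balaban1984PropagatorsII], (2.51)–(2.55) p. 232, (2.60)–(2.61) p. 234: THE WEIGHTED TWO-SPACE
# COMPOSITION OF 𝔅-BLOCK MAJORANTS WITH THE SCALE TRANSFER (2.60), for integer powers `(Lʲη)^γ` of the block weight, and the CLOSED-FORM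
# KERNEL STEPS `exp ⋆ exp`, `zone ⋆ exp`, `exp ⋆ zone → shape`, `exp ⋆ shape` under the profile (2.61) — the bookkeeping engine on which the
# block-majorant sizes of line 3 of (2.92) (`…B6DomainChangeP2134Sizes`) are assembled

statement-level skeleton of published theorems with citation tags; proofs where landed; nothing here is a claim about the Yang–Mills mass gap

PDF held: `paper:balaban1984-cmp96-propagators-rt-ii` (journal page = PDF page + 222); p. 232 [PDF 10] ((2.51)–(2.55)), p. 234 [PDF 12] ((2.60)–(2.61)),
p. 235 [PDF 13] ((2.67)), p. 238 [PDF 16] — read from the tree transcriptions of `…B6RandomWalk` (pv08), `…B6RandomWalkHom`, `…B6DomainMajorant` (b06).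
PRINT p. 232: *"|(R_iλ)(x)| ≤ K_i(y, y′)|λ|, x ∈ B^j(y), supp λ ⊂ B^{j′}(y′) … this property is preserved under the composition of operators possessing
it … A summation preserves it also"*; p. 234 (2.60) *"e^{−αδ₀d(y,y′)} ≤ e^{−αδ₀RM max{|j−j′|−1,0}}, y ∈ Λ_j, y′ ∈ Λ_{j′}"*, (2.61) *"sup_{y∈𝔅} Σ_{y′∈𝔅}
e^{−αδ₀d(y,y′)} ≤ c₁(α)"*; p. 235 (2.67) *"|(G′λ)(x)|, |(∇G′λ)(x)|, |(G′∇*λ)(x)|, |(∇G′∇*λ)(x)| ≤ B₁[(L^jη)², L^jη, L^jη, 1]e^{−δ₂d(y,y′)}|λ|"* — the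
majorants of the paper carry INTEGER POWERS of the block weight `L^jη` at the OUTPUT block.

CITATION HEADER (lean-in-tree rule) — WHAT IS REPRODUCED.  Phase-2 file of the `lit-balaban` typed skeleton (HOME `run/shared/lean/pub/lit-balaban/`), seat
**p38 gen 27**; B6-CLOSURE §5 item 7 bite (d4) second half (GAPS G-B6-p38-02 ADDENDUM 1 «what remains: … weights (L^jη)^{±2}, the (2.60) scale transfer,
the depth ≥ M of the cuts»); SKELETON rows **B6.Eq2.51** × **B6.Eq2.60** × **B6.Eq2.61** (cells only; decls of record untouched; referee ref-4).  The
siblings certify: pv08 `B6RandomWalk.hasMajorant_mul` ((2.52) ⇒ (2.55) on ONE lattice), `B6RandomWalkHom.hasMajorantHom_comp` (through a third lattice),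
b06 `B6DomainMajorant.hasMajorant_mul_weighted` (ONE weight `P(y)` on both factors, scale transfer `e^{−κd}P(y″) ≤ ΛP(y)`), `transfer_len_pow_of_ineq260`
((2.60) ⇒ the transfer for natural powers), `shape_conv_zone` (the (1.12)-shape of `expK ⋆ zoneK`).  THIS FILE adds what a product of up to seven factors
with DIFFERENT integer weights `w(y)^γ` (`γ ∈ ℤ`: `(L^jη)²` for `G′`, `L^jη` for `∇G′`/`G′∇*`, `(L^jη)^{−4}` for `(Q′G′²Q′*)⁻¹`, `(L^jη)^{−1}` for the
zone-born legs) between up to three lattices (sites, bonds, both through `𝔅`) needs: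
* §1 `shapeK` (the closed (1.12)-shape kernel `εe^{−δ(d + β(y) + β(y′))}`, as a kernel on `𝔅 × 𝔅`) and `transfer_zpow`: the one-step transfer
  `e^{−κd(y,y″)}w(y″) ≤ Λw(y)` (from (2.60): b06 `transfer_len_pow_of_ineq260` with `γ = 1`) implies `e^{−|γ|κd(y,y″)}w(y″)^γ ≤ Λ^{|γ|}w(y)^γ` for EVERY
  `γ ∈ ℤ` (negative powers by the symmetry of `d`);
* §2 **`comp_transfer`**: if `T₁ : (Y → ℝ) → (Z → ℝ)` has the majorant `w(y)^{γ₁}F(y,y″)` and `T₂ : (X → ℝ) → (Y → ℝ)` the majorant `w(y″)^{γ₂}H(y″,y′)`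
  (`F, H ≥ 0`), then `T₁T₂` has the majorant `Λ^{|γ₂|}w(y)^{γ₁+γ₂}Σ_{y″}e^{|γ₂|κd(y,y″)}F(y,y″)H(y″,y′)` — the inner weight is moved to the output block at
  the price of a tilt of the first kernel ((2.52) + (2.60));
* §3 the CLOSED-FORM STEPS under the profile `K` of (2.61) (`B6DomainChange.Profile`) and the pseudo-distance axioms (2.46)/(2.54): `step_exp_exp`
  (`expK(c₁,δ₁) ⋆ expK(c₂,r) ≤ expK(Λ^{|γ₂|}c₁c₂K(r/2), r/2)` for `r + |γ₂|κ ≤ δ₁`), `step_zone_exp` (a zone-row kernel `1_N(y)θe^{−δd}` stays zone-row),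
  `step_exp_zone` (`expK ⋆ zoneK` has the (1.12)-SHAPE with the depth of BOTH ends — b06 `shape_conv_zone`), `step_exp_shape` (`expK ⋆ shapeK` keeps the
  shape at half the rate — `B6DomainChange.Shape.mul_left`);
* §4 bounded multipliers and cuts for two-space majorants (`hom_mulOp_right/left`, the zone cut `hom_zoneCut_exp`: `(1 − χ)·T` with `χ = 1` off `N` turns
  `w^γexpK` into `w^γzoneK`), differences (`hom_sub_exp/zone`), weakenings (`hom_weaken_exp/zone/shape`), and the DEEP EVALUATION `deep_eval_shape`:
  a shape majorant `W(y)·εe^{−r(d + β(y) + β(y′))}` of `T` gives, for cut-offs `ζ`, `h` (`|·| ≤ 1`) living on blocks of depth `≥ M₀`, the majorant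
  `W(y)·εe^{−rM₀}e^{−rM₀}·e^{−rd(y,y′)}` of `ζ·T·h` — the printed *"factor e^{−δ₀M}"* of p. 238 (b06 `line3_deep_majorant`'s evaluation, kernel-generic).
No hypothesis-shaped fact; real-valued kernel `def` only (`shapeK`); standard axioms.
HONEST SCOPE / DIVERGENCES. Pure bookkeeping (the (2.51)–(2.55)/(2.60)/(2.61) calculus); every analytic input of a consumer stays displayed there. Rates
halve (or third, at the zone step) at each composition and lose `|γ₂|κ` to the transfer — the certificate's rates, not print's (cell DIVERGENCE D-b06.21).
The transfer hypothesis is the ONE-STEP form `e^{−κd(y,y″)}w(y″) ≤ Λw(y)` (for `w = L^jη`: (2.60) + the located size condition `Le^{−κRM} ≤ 1`, b06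
`transfer_len_pow_of_ineq260`); `Λ ≥ 1` is not assumed (it follows where needed from `w > 0`).  Nothing on d = 4 or the continuum; NOT summit progress.
Unit `lit-balaban-p38` (gen 27), 2026-08-23.
-/

namespace Literature.MathematicalPhysics.QuantumFieldTheory.Balaban1983to89.B6MajorantTransferSteps

open B4Sect5Torus (IsPseudoDist)
open B6DomainChange (IsDepth Profile Decay Shape isDepth_zero core_sum)
open B6DomainMajorant (expK zoneK expK_apply zoneK_apply expK_nonneg zoneK_nonneg ind_nonneg shape_conv_zone decay_expK)
open B6RandomWalk (HasMajorant BlockSupp hasMajorant_mono)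
open B6RandomWalkHom (HasMajorantHom hasMajorantHom_comp hasMajorantHom_mono hasMajorantHom_add)
open B9Thm37Sum (mulOp mulOp_apply)

variable {g : B6.Geometry}

/-! ## §1  The shape kernel; the scale transfer for integer powers of the block weight -/

/-- the closed (1.12)-SHAPE kernel on `𝔅 × 𝔅`: `εe^{−δ(d(y,y′) + β(y) + β(y′))}` with the depth `β` of BOTH ends (the bound of b06's `shape_conv_zone`
as a function). [cite: Balaban1984PropagatorsII, p.238 («the usual estimate of the type (1.12) [3] connected with a change of a domain»); Balaban1983RegularityDecay, (1.12) p.573] -/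
noncomputable def shapeK (g : B6.Geometry) (β : g.Site → ℝ) (ε δ : ℝ) : Matrix g.Site g.Site ℝ :=
  Matrix.of fun a b => ε * Real.exp (-(δ * (g.dist a b + β a + β b)))

/-- entries of `shapeK`. [cite: Balaban1984PropagatorsII, p.238] -/
@[simp] theorem shapeK_apply (β : g.Site → ℝ) (ε δ : ℝ) (a b : g.Site) :
    shapeK g β ε δ a b = ε * Real.exp (-(δ * (g.dist a b + β a + β b))) := rfl

/-- `shapeK ≥ 0` for `ε ≥ 0`. [cite: Balaban1984PropagatorsII, p.238] -/
theorem shapeK_nonneg (β : g.Site → ℝ) {ε : ℝ} (hε : 0 ≤ ε) (δ : ℝ) (a b : g.Site) : 0 ≤ shapeK g β ε δ a b := by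
  rw [shapeK_apply]; positivity

/-- `shapeK` IS a `B6DomainChange.Shape` kernel (positions `id`), for `ε ≥ 0`. [cite: Balaban1984PropagatorsII, p.238; Balaban1983RegularityDecay, (1.12) p.573] -/
theorem shape_shapeK (β : g.Site → ℝ) {ε : ℝ} (hε : 0 ≤ ε) (δ : ℝ) :
    Shape g.dist β (fun a : g.Site => a) (fun a : g.Site => a) ε δ (shapeK g β ε δ) := by
  intro a b
  rw [abs_of_nonneg (shapeK_nonneg β hε δ a b), shapeK_apply]

/-- lowering the rate / raising the constant raises the shape kernel (`d + β + β ≥ 0`). [cite: Balaban1984PropagatorsII, p.238] -/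
theorem shapeK_mono (hρ : IsPseudoDist g.dist) {β : g.Site → ℝ} (hβ : IsDepth g.dist β) {ε ε' δ δ' : ℝ} (hε : 0 ≤ ε) (hεε : ε ≤ ε')
    (hδ : δ' ≤ δ) (a b : g.Site) : shapeK g β ε δ a b ≤ shapeK g β ε' δ' a b := by
  rw [shapeK_apply, shapeK_apply]
  have hS : 0 ≤ g.dist a b + β a + β b := add_nonneg (add_nonneg (hρ.nonneg a b) (hβ.nonneg a)) (hβ.nonneg b)
  exact mul_le_mul hεε (Real.exp_le_exp.2 (by nlinarith)) (Real.exp_pos _).le (hε.trans hεε)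

/-- **THE SCALE TRANSFER FOR INTEGER POWERS.**  If `e^{−κd(y,y″)}w(y″) ≤ Λw(y)` for all `y, y″` (for `w(y) = L^jη`: (2.60) — one layer costs `RM` in `d`
and a factor `L` in the weight), `w > 0` and `d` is symmetric, then for every `γ ∈ ℤ`: `e^{−|γ|κd(y,y″)}w(y″)^γ ≤ Λ^{|γ|}w(y)^γ` (negative powers: apply the
hypothesis with `y, y″` exchanged). [cite: Balaban1984PropagatorsII, (2.60) p.234] -/
theorem transfer_zpow {w : g.Site → ℝ} (hw : ∀ a, 0 < w a) (hsymm : ∀ a c, g.dist a c = g.dist c a) {κ Λ : ℝ}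
    (hT : ∀ a c, Real.exp (-(κ * g.dist a c)) * w c ≤ Λ * w a) (γ : ℤ) (a c : g.Site) :
    Real.exp (-((γ.natAbs : ℝ) * κ * g.dist a c)) * w c ^ γ ≤ Λ ^ γ.natAbs * w a ^ γ := by
  cases γ with
  | ofNat n =>
      simp only [Int.ofNat_eq_natCast, Int.natAbs_natCast, zpow_natCast]
      have e : Real.exp (-((n : ℝ) * κ * g.dist a c)) = Real.exp (-(κ * g.dist a c)) ^ n := by
        rw [← Real.exp_nat_mul]; congr 1; ring
      rw [e, ← mul_pow, ← mul_pow]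
      exact pow_le_pow_left₀ (mul_nonneg (Real.exp_pos _).le (hw c).le) (hT a c) n
  | negSucc n =>
      simp only [Int.natAbs_negSucc, zpow_negSucc]
      have h := hT c a
      rw [hsymm c a] at h
      have hn : (Real.exp (-(κ * g.dist a c)) * w a) ^ (n + 1) ≤ (Λ * w c) ^ (n + 1) :=
        pow_le_pow_left₀ (mul_nonneg (Real.exp_pos _).le (hw a).le) h _
      rw [mul_pow, mul_pow, ← Real.exp_nat_mul] at hn
      have hwa : 0 < w a ^ (n + 1) := pow_pos (hw a) _
      have hwc : 0 < w c ^ (n + 1) := pow_pos (hw c) _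
      have e : Real.exp (-(((n + 1 : ℕ) : ℝ) * κ * g.dist a c)) = Real.exp (((n + 1 : ℕ) : ℝ) * -(κ * g.dist a c)) := by
        congr 1; ring
      rw [Nat.succ_eq_add_one, e, ← div_eq_mul_inv, ← div_eq_mul_inv, div_le_div_iff₀ hwc hwa]
      exact hn

/-- the transfer constant is at least `1` once the distance vanishes on the diagonal (`d(y,y) = 0`, `w > 0`). [cite: Balaban1984PropagatorsII, (2.60) p.234, (2.46) p.231] -/
theorem one_le_transfer {w : g.Site → ℝ} (hw : ∀ a, 0 < w a) (hρ : IsPseudoDist g.dist) {κ Λ : ℝ}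
    (hT : ∀ a c, Real.exp (-(κ * g.dist a c)) * w c ≤ Λ * w a) (a : g.Site) : 1 ≤ Λ := by
  have h := hT a a
  rw [hρ.zero a, mul_zero, neg_zero, Real.exp_zero, one_mul] at h
  exact le_of_mul_le_mul_right (by linarith : 1 * w a ≤ Λ * w a) (hw a)

/-! ## §2  The weighted two-space composition with transfer -/

section Comp

variable {X Y Z : Type}

/-- **(2.52)/(2.55) WITH THE SCALE TRANSFER (2.60), TWO SPACES, INTEGER WEIGHTS.**  If `T₁ : (Y → ℝ) → (Z → ℝ)` has the `𝔅`-majorant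
`w(y)^{γ₁}F(y,y″)` and `T₂ : (X → ℝ) → (Y → ℝ)` the `𝔅`-majorant `w(y″)^{γ₂}H(y″,y′)` (`F, H ≥ 0`, `w > 0`, `d` symmetric, one-step transfer
`e^{−κd}w(y″) ≤ Λw(y)`), then `T₁T₂` has the `𝔅`-majorant `Λ^{|γ₂|}·w(y)^{γ₁+γ₂}·Σ_{y″} e^{|γ₂|κd(y,y″)}F(y,y″)H(y″,y′)`: insert `Σ_{y″}Δ(y″) = I` between the
factors ((2.52)) and move the inner weight to the output block by (2.60), tilting the first kernel. [cite: Balaban1984PropagatorsII, (2.52)–(2.55) p.232, (2.60) p.234] -/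
theorem comp_transfer (blkX : X → g.Site) (blkY : Y → g.Site) (blkZ : Z → g.Site)
    {w : g.Site → ℝ} (hw : ∀ a, 0 < w a) (hsymm : ∀ a c, g.dist a c = g.dist c a) {κ Λ : ℝ}
    (hT : ∀ a c, Real.exp (-(κ * g.dist a c)) * w c ≤ Λ * w a)
    {T₁ : (Y → ℝ) →ₗ[ℝ] (Z → ℝ)} {T₂ : (X → ℝ) →ₗ[ℝ] (Y → ℝ)} {γ₁ γ₂ : ℤ} {F H : g.Site → g.Site → ℝ}
    (h₁ : HasMajorantHom blkY blkZ T₁ (fun a c => w a ^ γ₁ * F a c))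
    (h₂ : HasMajorantHom blkX blkY T₂ (fun c b => w c ^ γ₂ * H c b))
    (hF : ∀ a c, 0 ≤ F a c) (hH : ∀ c b, 0 ≤ H c b) :
    HasMajorantHom blkX blkZ (T₁ ∘ₗ T₂)
      (fun a b => Λ ^ γ₂.natAbs * w a ^ (γ₁ + γ₂) * ∑ c, Real.exp ((γ₂.natAbs : ℝ) * κ * g.dist a c) * F a c * H c b) := by
  have hK₂ : ∀ c b, 0 ≤ w c ^ γ₂ * H c b := fun c b => mul_nonneg (zpow_nonneg (hw c).le _) (hH c b)
  refine hasMajorantHom_mono blkX blkZ (hasMajorantHom_comp blkX blkY blkZ h₁ h₂ hK₂) (fun a b => ?_)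
  rw [Finset.mul_sum]
  refine Finset.sum_le_sum fun c _ => ?_
  set x : ℝ := (γ₂.natAbs : ℝ) * κ * g.dist a c with hx
  have ht := transfer_zpow hw hsymm hT γ₂ a c
  have hwc : w c ^ γ₂ ≤ Real.exp x * (Λ ^ γ₂.natAbs * w a ^ γ₂) := by
    calc w c ^ γ₂ = Real.exp x * (Real.exp (-x) * w c ^ γ₂) := by
          rw [← mul_assoc, ← Real.exp_add, add_neg_cancel, Real.exp_zero, one_mul]
      _ ≤ Real.exp x * (Λ ^ γ₂.natAbs * w a ^ γ₂) := mul_le_mul_of_nonneg_left (by rw [hx]; exact ht) (Real.exp_pos _).le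
  have hwa : w a ^ (γ₁ + γ₂) = w a ^ γ₁ * w a ^ γ₂ := zpow_add₀ (hw a).ne' _ _
  have h0 : 0 ≤ w a ^ γ₁ * F a c * H c b := mul_nonneg (mul_nonneg (zpow_nonneg (hw a).le _) (hF a c)) (hH c b)
  calc w a ^ γ₁ * F a c * (w c ^ γ₂ * H c b) = (w a ^ γ₁ * F a c * H c b) * w c ^ γ₂ := by ring
    _ ≤ (w a ^ γ₁ * F a c * H c b) * (Real.exp x * (Λ ^ γ₂.natAbs * w a ^ γ₂)) := mul_le_mul_of_nonneg_left hwc h0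
    _ = Λ ^ γ₂.natAbs * w a ^ (γ₁ + γ₂) * (Real.exp x * F a c * H c b) := by rw [hwa]; ring

end Comp

/-! ## §3  The closed-form kernel steps under the profile (2.61) -/

section Steps

variable [DecidableEq g.Site] {X Y Z : Type}

omit [DecidableEq g.Site] in
/-- the one-step summation of (2.61)-type with no depth: `Σ_u c₁e^{−r d(a,u)}·c₂e^{−r d(u,b)} ≤ c₁c₂K(r/2)e^{−(r/2)d(a,b)}`.
[cite: Balaban1984PropagatorsII, (2.61)–(2.63) p.234] -/
theorem core_sum_zero (hρ : IsPseudoDist g.dist) {K : ℝ → ℝ} (hPr : Profile g.dist (fun a : g.Site => a) K) {r c₁ c₂ : ℝ}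
    (hr : 0 < r) (hc₁ : 0 ≤ c₁) (hc₂ : 0 ≤ c₂) (a b : g.Site) :
    ∑ u, c₁ * Real.exp (-(r * g.dist a u)) * (c₂ * Real.exp (-(r * g.dist u b))) ≤
      c₁ * c₂ * K (r / 2) * Real.exp (-(r / 2 * g.dist a b)) := by
  have h := core_sum hρ (isDepth_zero hρ) hPr hr hc₁ hc₂ a b
  simpa only [add_zero] using h

omit [DecidableEq g.Site] in
/-- a tilted decaying kernel at a lower rate: `e^{nκd}·c e^{−δ₁d} ≤ c e^{−rd}` for `r + nκ ≤ δ₁`, `d ≥ 0`, `c ≥ 0`. [cite: Balaban1984PropagatorsII, (2.60) p.234] -/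
theorem tilt_expK_le (hρ : IsPseudoDist g.dist) {n κ c δ₁ r : ℝ} (hc : 0 ≤ c) (hr : r + n * κ ≤ δ₁) (a u : g.Site) :
    Real.exp (n * κ * g.dist a u) * expK g c δ₁ a u ≤ c * Real.exp (-(r * g.dist a u)) := by
  rw [expK_apply, mul_left_comm, ← Real.exp_add]
  exact mul_le_mul_of_nonneg_left (Real.exp_le_exp.2 (by nlinarith [hρ.nonneg a u])) hc

omit [DecidableEq g.Site] in
/-- **STEP `exp ⋆ exp`**: majorants `w^{γ₁}expK(c₁, δ₁)` and `w^{γ₂}expK(c₂, r)` with `r + |γ₂|κ ≤ δ₁`, `0 < r`, compose to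
`w^{γ₁+γ₂}expK(Λ^{|γ₂|}c₁c₂K(r/2), r/2)`. [cite: Balaban1984PropagatorsII, (2.52)–(2.55) p.232, (2.60)–(2.61) p.234] -/
theorem step_exp_exp (blkX : X → g.Site) (blkY : Y → g.Site) (blkZ : Z → g.Site) (hρ : IsPseudoDist g.dist)
    {K : ℝ → ℝ} (hPr : Profile g.dist (fun a : g.Site => a) K)
    {w : g.Site → ℝ} (hw : ∀ a, 0 < w a) {κ Λ : ℝ} (hT : ∀ a c, Real.exp (-(κ * g.dist a c)) * w c ≤ Λ * w a)
    {T₁ : (Y → ℝ) →ₗ[ℝ] (Z → ℝ)} {T₂ : (X → ℝ) →ₗ[ℝ] (Y → ℝ)} {γ₁ γ₂ : ℤ} {c₁ δ₁ c₂ r : ℝ}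
    (hc₁ : 0 ≤ c₁) (hc₂ : 0 ≤ c₂) (hr : 0 < r) (hrδ : r + γ₂.natAbs * κ ≤ δ₁)
    (h₁ : HasMajorantHom blkY blkZ T₁ (fun a c => w a ^ γ₁ * expK g c₁ δ₁ a c))
    (h₂ : HasMajorantHom blkX blkY T₂ (fun c b => w c ^ γ₂ * expK g c₂ r c b)) :
    HasMajorantHom blkX blkZ (T₁ ∘ₗ T₂)
      (fun a b => w a ^ (γ₁ + γ₂) * expK g (Λ ^ γ₂.natAbs * c₁ * c₂ * K (r / 2)) (r / 2) a b) := by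
  have hc := comp_transfer blkX blkY blkZ hw hρ.symm hT h₁ h₂ (expK_nonneg hc₁ δ₁) (expK_nonneg hc₂ r)
  refine hasMajorantHom_mono blkX blkZ hc (fun a b => ?_)
  have hΛ : 0 ≤ Λ ^ γ₂.natAbs := pow_nonneg (zero_le_one.trans (one_le_transfer hw hρ hT a)) _
  have hsum : ∑ c, Real.exp ((γ₂.natAbs : ℝ) * κ * g.dist a c) * expK g c₁ δ₁ a c * expK g c₂ r c b ≤
      c₁ * c₂ * K (r / 2) * Real.exp (-(r / 2 * g.dist a b)) := by
    refine le_trans (Finset.sum_le_sum fun u _ => ?_) (core_sum_zero hρ hPr hr hc₁ hc₂ a b)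
    rw [expK_apply c₂ r u b]
    exact mul_le_mul_of_nonneg_right (tilt_expK_le hρ hc₁ hrδ a u) (by positivity)
  calc Λ ^ γ₂.natAbs * w a ^ (γ₁ + γ₂) * ∑ c, Real.exp ((γ₂.natAbs : ℝ) * κ * g.dist a c) * expK g c₁ δ₁ a c * expK g c₂ r c b
      ≤ Λ ^ γ₂.natAbs * w a ^ (γ₁ + γ₂) * (c₁ * c₂ * K (r / 2) * Real.exp (-(r / 2 * g.dist a b))) :=
        mul_le_mul_of_nonneg_left hsum (mul_nonneg hΛ (zpow_nonneg (hw a).le _))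
    _ = w a ^ (γ₁ + γ₂) * expK g (Λ ^ γ₂.natAbs * c₁ * c₂ * K (r / 2)) (r / 2) a b := by rw [expK_apply]; ring

/-- **STEP `zone ⋆ exp`**: a ZONE-ROW majorant `w^{γ₁}zoneK(N, θ, δ₁)` (rows living on the blocks of the zone `N`) followed by `w^{γ₂}expK(c₂, r)`,
`r + |γ₂|κ ≤ δ₁`, stays zone-row: `w^{γ₁+γ₂}zoneK(N, Λ^{|γ₂|}θc₂K(r/2), r/2)`. [cite: Balaban1984PropagatorsII, (2.52)–(2.55) p.232, (2.60)–(2.61) p.234, p.238] -/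
theorem step_zone_exp (blkX : X → g.Site) (blkY : Y → g.Site) (blkZ : Z → g.Site) (hρ : IsPseudoDist g.dist)
    {K : ℝ → ℝ} (hPr : Profile g.dist (fun a : g.Site => a) K)
    {w : g.Site → ℝ} (hw : ∀ a, 0 < w a) {κ Λ : ℝ} (hT : ∀ a c, Real.exp (-(κ * g.dist a c)) * w c ≤ Λ * w a)
    (N : Finset g.Site) {T₁ : (Y → ℝ) →ₗ[ℝ] (Z → ℝ)} {T₂ : (X → ℝ) →ₗ[ℝ] (Y → ℝ)} {γ₁ γ₂ : ℤ} {θ δ₁ c₂ r : ℝ}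
    (hθ : 0 ≤ θ) (hc₂ : 0 ≤ c₂) (hr : 0 < r) (hrδ : r + γ₂.natAbs * κ ≤ δ₁)
    (h₁ : HasMajorantHom blkY blkZ T₁ (fun a c => w a ^ γ₁ * zoneK g N θ δ₁ a c))
    (h₂ : HasMajorantHom blkX blkY T₂ (fun c b => w c ^ γ₂ * expK g c₂ r c b)) :
    HasMajorantHom blkX blkZ (T₁ ∘ₗ T₂)
      (fun a b => w a ^ (γ₁ + γ₂) * zoneK g N (Λ ^ γ₂.natAbs * θ * c₂ * K (r / 2)) (r / 2) a b) := by
  have hc := comp_transfer blkX blkY blkZ hw hρ.symm hT h₁ h₂ (zoneK_nonneg N hθ δ₁) (expK_nonneg hc₂ r)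
  refine hasMajorantHom_mono blkX blkZ hc (fun a b => ?_)
  have hΛ : 0 ≤ Λ ^ γ₂.natAbs := pow_nonneg (zero_le_one.trans (one_le_transfer hw hρ hT a)) _
  have hwγ : 0 ≤ w a ^ (γ₁ + γ₂) := zpow_nonneg (hw a).le _
  by_cases ha : a ∈ N
  · have hsum : ∑ c, Real.exp ((γ₂.natAbs : ℝ) * κ * g.dist a c) * zoneK g N θ δ₁ a c * expK g c₂ r c b ≤
        θ * c₂ * K (r / 2) * Real.exp (-(r / 2 * g.dist a b)) := by
      refine le_trans (Finset.sum_le_sum fun u _ => ?_) (core_sum_zero hρ hPr hr hθ hc₂ a b)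
      have ez : zoneK g N θ δ₁ a u = expK g θ δ₁ a u := by rw [zoneK_apply, expK_apply, if_pos ha]
      rw [ez, expK_apply c₂ r u b]
      exact mul_le_mul_of_nonneg_right (tilt_expK_le hρ hθ hrδ a u) (by positivity)
    calc Λ ^ γ₂.natAbs * w a ^ (γ₁ + γ₂) * ∑ c, Real.exp ((γ₂.natAbs : ℝ) * κ * g.dist a c) * zoneK g N θ δ₁ a c * expK g c₂ r c b
        ≤ Λ ^ γ₂.natAbs * w a ^ (γ₁ + γ₂) * (θ * c₂ * K (r / 2) * Real.exp (-(r / 2 * g.dist a b))) :=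
          mul_le_mul_of_nonneg_left hsum (mul_nonneg hΛ hwγ)
      _ = w a ^ (γ₁ + γ₂) * zoneK g N (Λ ^ γ₂.natAbs * θ * c₂ * K (r / 2)) (r / 2) a b := by
          rw [zoneK_apply, if_pos ha]; ring
  · have hz : ∀ c, zoneK g N θ δ₁ a c = 0 := fun c => by rw [zoneK_apply, if_neg ha, zero_mul]
    have e0 : ∑ c, Real.exp ((γ₂.natAbs : ℝ) * κ * g.dist a c) * zoneK g N θ δ₁ a c * expK g c₂ r c b = 0 :=
      Finset.sum_eq_zero fun c _ => by rw [hz c, mul_zero, zero_mul]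
    rw [e0, mul_zero, zoneK_apply, if_neg ha, zero_mul, mul_zero]

/-- **STEP `exp ⋆ zone → shape`**: `w^{γ₁}expK(c₁, δ₁)` followed by a zone-row `w^{γ₂}zoneK(N, θ, r)`, `r + |γ₂|κ ≤ δ₁`, has the (1.12)-SHAPE with the
depth `β` (vanishing on `N`) of BOTH ends: `w^{γ₁+γ₂}shapeK(β, Λ^{|γ₂|}c₁θK(r/3), r/3)` — a propagator leg INTO the zone followed by a zone-born leg
(b06 `shape_conv_zone`). [cite: Balaban1984PropagatorsII, p.238 («connected with a change of a domain»), (2.60)–(2.61) p.234] -/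
theorem step_exp_zone (blkX : X → g.Site) (blkY : Y → g.Site) (blkZ : Z → g.Site) (hρ : IsPseudoDist g.dist)
    {β : g.Site → ℝ} (hβ : IsDepth g.dist β) {K : ℝ → ℝ} (hPr : Profile g.dist (fun a : g.Site => a) K)
    (N : Finset g.Site) (hN : ∀ a ∈ N, β a = 0)
    {w : g.Site → ℝ} (hw : ∀ a, 0 < w a) {κ Λ : ℝ} (hT : ∀ a c, Real.exp (-(κ * g.dist a c)) * w c ≤ Λ * w a)
    {T₁ : (Y → ℝ) →ₗ[ℝ] (Z → ℝ)} {T₂ : (X → ℝ) →ₗ[ℝ] (Y → ℝ)} {γ₁ γ₂ : ℤ} {c₁ δ₁ θ r : ℝ}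
    (hc₁ : 0 ≤ c₁) (hθ : 0 ≤ θ) (hr : 0 < r) (hrδ : r + γ₂.natAbs * κ ≤ δ₁)
    (h₁ : HasMajorantHom blkY blkZ T₁ (fun a c => w a ^ γ₁ * expK g c₁ δ₁ a c))
    (h₂ : HasMajorantHom blkX blkY T₂ (fun c b => w c ^ γ₂ * zoneK g N θ r c b)) :
    HasMajorantHom blkX blkZ (T₁ ∘ₗ T₂)
      (fun a b => w a ^ (γ₁ + γ₂) * shapeK g β (Λ ^ γ₂.natAbs * c₁ * θ * K (r / 3)) (r / 3) a b) := by
  have hc := comp_transfer blkX blkY blkZ hw hρ.symm hT h₁ h₂ (expK_nonneg hc₁ δ₁) (zoneK_nonneg N hθ r)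
  refine hasMajorantHom_mono blkX blkZ hc (fun a b => ?_)
  have hΛ : 0 ≤ Λ ^ γ₂.natAbs := pow_nonneg (zero_le_one.trans (one_le_transfer hw hρ hT a)) _
  have hwγ : 0 ≤ w a ^ (γ₁ + γ₂) := zpow_nonneg (hw a).le _
  have h1 : ∑ c, Real.exp ((γ₂.natAbs : ℝ) * κ * g.dist a c) * expK g c₁ δ₁ a c * zoneK g N θ r c b ≤
      (expK g c₁ r * zoneK g N θ r) a b := by
    rw [Matrix.mul_apply]
    refine Finset.sum_le_sum fun u _ => mul_le_mul_of_nonneg_right ?_ (zoneK_nonneg N hθ r u b)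
    rw [expK_apply c₁ r a u]
    exact tilt_expK_le hρ hc₁ hrδ a u
  have h2 := shape_conv_zone hρ hβ hPr N hN hr hc₁ hθ a b
  calc Λ ^ γ₂.natAbs * w a ^ (γ₁ + γ₂) * ∑ c, Real.exp ((γ₂.natAbs : ℝ) * κ * g.dist a c) * expK g c₁ δ₁ a c * zoneK g N θ r c b
      ≤ Λ ^ γ₂.natAbs * w a ^ (γ₁ + γ₂) * (c₁ * θ * K (r / 3) * Real.exp (-(r / 3 * (g.dist a b + β a + β b)))) :=
        mul_le_mul_of_nonneg_left (h1.trans ((le_abs_self _).trans h2)) (mul_nonneg hΛ hwγ)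
    _ = w a ^ (γ₁ + γ₂) * shapeK g β (Λ ^ γ₂.natAbs * c₁ * θ * K (r / 3)) (r / 3) a b := by rw [shapeK_apply]; ring

omit [DecidableEq g.Site] in
/-- **STEP `exp ⋆ shape`**: `w^{γ₁}expK(c₁, δ₁)` followed by a shape `w^{γ₂}shapeK(β, ε, r)`, `r + |γ₂|κ ≤ δ₁`, keeps the shape at half the rate:
`w^{γ₁+γ₂}shapeK(β, Λ^{|γ₂|}c₁εK(r/2), r/2)` (`B6DomainChange.Shape.mul_left`: the depth crosses the middle block by the Lipschitz property).
[cite: Balaban1984PropagatorsII, (2.52)–(2.55) p.232, (2.60)–(2.61) p.234, p.238] -/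
theorem step_exp_shape (blkX : X → g.Site) (blkY : Y → g.Site) (blkZ : Z → g.Site) (hρ : IsPseudoDist g.dist)
    {β : g.Site → ℝ} (hβ : IsDepth g.dist β) {K : ℝ → ℝ} (hPr : Profile g.dist (fun a : g.Site => a) K)
    {w : g.Site → ℝ} (hw : ∀ a, 0 < w a) {κ Λ : ℝ} (hT : ∀ a c, Real.exp (-(κ * g.dist a c)) * w c ≤ Λ * w a)
    {T₁ : (Y → ℝ) →ₗ[ℝ] (Z → ℝ)} {T₂ : (X → ℝ) →ₗ[ℝ] (Y → ℝ)} {γ₁ γ₂ : ℤ} {c₁ δ₁ ε r : ℝ}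
    (hc₁ : 0 ≤ c₁) (hε : 0 ≤ ε) (hr : 0 < r) (hrδ : r + γ₂.natAbs * κ ≤ δ₁)
    (h₁ : HasMajorantHom blkY blkZ T₁ (fun a c => w a ^ γ₁ * expK g c₁ δ₁ a c))
    (h₂ : HasMajorantHom blkX blkY T₂ (fun c b => w c ^ γ₂ * shapeK g β ε r c b)) :
    HasMajorantHom blkX blkZ (T₁ ∘ₗ T₂)
      (fun a b => w a ^ (γ₁ + γ₂) * shapeK g β (Λ ^ γ₂.natAbs * c₁ * ε * K (r / 2)) (r / 2) a b) := by
  have hc := comp_transfer blkX blkY blkZ hw hρ.symm hT h₁ h₂ (expK_nonneg hc₁ δ₁) (shapeK_nonneg β hε r)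
  refine hasMajorantHom_mono blkX blkZ hc (fun a b => ?_)
  have hΛ : 0 ≤ Λ ^ γ₂.natAbs := pow_nonneg (zero_le_one.trans (one_le_transfer hw hρ hT a)) _
  have hwγ : 0 ≤ w a ^ (γ₁ + γ₂) := zpow_nonneg (hw a).le _
  have h1 : ∑ c, Real.exp ((γ₂.natAbs : ℝ) * κ * g.dist a c) * expK g c₁ δ₁ a c * shapeK g β ε r c b ≤
      (expK g c₁ r * shapeK g β ε r) a b := by
    rw [Matrix.mul_apply]
    refine Finset.sum_le_sum fun u _ => mul_le_mul_of_nonneg_right ?_ (shapeK_nonneg β hε r u b)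
    rw [expK_apply c₁ r a u]
    exact tilt_expK_le hρ hc₁ hrδ a u
  have h2 := B6DomainChange.Shape.mul_left hρ hβ hPr hr hε hc₁ (decay_expK hc₁ r) (shape_shapeK β hε r) a b
  calc Λ ^ γ₂.natAbs * w a ^ (γ₁ + γ₂) * ∑ c, Real.exp ((γ₂.natAbs : ℝ) * κ * g.dist a c) * expK g c₁ δ₁ a c * shapeK g β ε r c b
      ≤ Λ ^ γ₂.natAbs * w a ^ (γ₁ + γ₂) * (c₁ * ε * K (r / 2) * Real.exp (-(r / 2 * (g.dist a b + β a + β b)))) :=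
        mul_le_mul_of_nonneg_left (h1.trans ((le_abs_self _).trans h2)) (mul_nonneg hΛ hwγ)
    _ = w a ^ (γ₁ + γ₂) * shapeK g β (Λ ^ γ₂.natAbs * c₁ * ε * K (r / 2)) (r / 2) a b := by rw [shapeK_apply]; ring

end Steps

/-! ## §4  Multipliers, cuts, differences, weakenings; the deep evaluation -/

section Tools

variable {X Y : Type}

/-- a bounded multiplier on the right (`|f| ≤ 1`) keeps a two-space majorant. [cite: Balaban1984PropagatorsII, (2.51) p.232] -/
theorem hom_mulOp_right (blkX : X → g.Site) (blkY : Y → g.Site) {T : (X → ℝ) →ₗ[ℝ] (Y → ℝ)} {K : g.Site → g.Site → ℝ}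
    (hT : HasMajorantHom blkX blkY T K) (f : X → ℝ) (hf : ∀ x, |f x| ≤ 1) : HasMajorantHom blkX blkY (T ∘ₗ mulOp f) K := by
  intro y' μ B hμ v
  have hμ' : BlockSupp blkX (mulOp f μ) y' B := by
    refine ⟨hμ.nonneg, fun x' hx' => ?_, fun x' hx' => ?_⟩
    · rw [mulOp_apply, abs_mul]
      calc |f x'| * |μ x'| ≤ 1 * B := mul_le_mul (hf x') (hμ.bound x' hx') (abs_nonneg _) zero_le_one
        _ = B := one_mul B
    · rw [mulOp_apply, hμ.off x' hx', mul_zero]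
  rw [LinearMap.comp_apply]
  exact hT y' _ B hμ' v

/-- a bounded multiplier on the left (`|f| ≤ 1`) keeps a two-space majorant. [cite: Balaban1984PropagatorsII, (2.51) p.232] -/
theorem hom_mulOp_left (blkX : X → g.Site) (blkY : Y → g.Site) {T : (X → ℝ) →ₗ[ℝ] (Y → ℝ)} {K : g.Site → g.Site → ℝ}
    (hT : HasMajorantHom blkX blkY T K) (f : Y → ℝ) (hf : ∀ v, |f v| ≤ 1) : HasMajorantHom blkX blkY (mulOp f ∘ₗ T) K := by
  intro y' μ B hμ v
  rw [LinearMap.comp_apply, mulOp_apply, abs_mul]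
  calc |f v| * |T μ v| ≤ 1 * (K (blkY v) y' * B) := mul_le_mul (hf v) (hT y' μ B hμ v) (abs_nonneg _) zero_le_one
    _ = K (blkY v) y' * B := one_mul _

variable [DecidableEq g.Site]

/-- **the zone cut**: a multiplier `f` with `|f| ≤ 1` vanishing on the blocks outside `N` (e.g. `1 − χ` with `χ = 1` off the zone) in front of `T` with
majorant `w^γexpK(c, δ)` gives the ZONE-ROW majorant `w^γzoneK(N, c, δ)`. [cite: Balaban1984PropagatorsII, (2.51) p.232, p.238] -/
theorem hom_zoneCut_exp (blkX : X → g.Site) (blkY : Y → g.Site) {T : (X → ℝ) →ₗ[ℝ] (Y → ℝ)} {w : g.Site → ℝ} {γ : ℤ} {c δ : ℝ}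
    (hT : HasMajorantHom blkX blkY T (fun a b => w a ^ γ * expK g c δ a b)) (f : Y → ℝ) (hf : ∀ v, |f v| ≤ 1)
    (N : Finset g.Site) (hf0 : ∀ v, blkY v ∉ N → f v = 0) :
    HasMajorantHom blkX blkY (mulOp f ∘ₗ T) (fun a b => w a ^ γ * zoneK g N c δ a b) := by
  intro y' μ B hμ v
  dsimp only
  rw [LinearMap.comp_apply, mulOp_apply, abs_mul]
  by_cases hv : blkY v ∈ N
  · have e : zoneK g N c δ (blkY v) y' = expK g c δ (blkY v) y' := by rw [zoneK_apply, expK_apply, if_pos hv]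
    rw [e]
    calc |f v| * |T μ v| ≤ 1 * (w (blkY v) ^ γ * expK g c δ (blkY v) y' * B) :=
          mul_le_mul (hf v) (hT y' μ B hμ v) (abs_nonneg _) zero_le_one
      _ = _ := one_mul _
  · rw [hf0 v hv, abs_zero, zero_mul, zoneK_apply, if_neg hv, zero_mul, mul_zero, zero_mul]

omit [DecidableEq g.Site] in
/-- majorants of a difference add (two spaces). [cite: Balaban1984PropagatorsII, p.232 («A summation preserves it also»)] -/
theorem hom_sub (blkX : X → g.Site) (blkY : Y → g.Site) {T₁ T₂ : (X → ℝ) →ₗ[ℝ] (Y → ℝ)} {K₁ K₂ : g.Site → g.Site → ℝ}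
    (h₁ : HasMajorantHom blkX blkY T₁ K₁) (h₂ : HasMajorantHom blkX blkY T₂ K₂) :
    HasMajorantHom blkX blkY (T₁ - T₂) (fun a b => K₁ a b + K₂ a b) := by
  intro y' μ B hμ v
  rw [LinearMap.sub_apply, Pi.sub_apply, add_mul]
  exact (abs_sub _ _).trans (add_le_add (h₁ y' μ B hμ v) (h₂ y' μ B hμ v))

omit [DecidableEq g.Site] in
/-- difference of two `w^γexpK(cᵢ, δ)` majorants: `w^γexpK(c₁ + c₂, δ)`. [cite: Balaban1984PropagatorsII, p.232] -/
theorem hom_sub_exp (blkX : X → g.Site) (blkY : Y → g.Site) {T₁ T₂ : (X → ℝ) →ₗ[ℝ] (Y → ℝ)} {w : g.Site → ℝ} {γ : ℤ} {c₁ c₂ δ : ℝ}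
    (h₁ : HasMajorantHom blkX blkY T₁ (fun a b => w a ^ γ * expK g c₁ δ a b))
    (h₂ : HasMajorantHom blkX blkY T₂ (fun a b => w a ^ γ * expK g c₂ δ a b)) :
    HasMajorantHom blkX blkY (T₁ - T₂) (fun a b => w a ^ γ * expK g (c₁ + c₂) δ a b) :=
  hasMajorantHom_mono blkX blkY (hom_sub blkX blkY h₁ h₂) fun a b => by rw [expK_apply, expK_apply, expK_apply]; ring_nf; rfl

/-- difference of two `w^γzoneK(N, θᵢ, δ)` majorants: `w^γzoneK(N, θ₁ + θ₂, δ)`. [cite: Balaban1984PropagatorsII, p.232, p.238] -/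
theorem hom_sub_zone (blkX : X → g.Site) (blkY : Y → g.Site) {T₁ T₂ : (X → ℝ) →ₗ[ℝ] (Y → ℝ)} {w : g.Site → ℝ} {γ : ℤ}
    (N : Finset g.Site) {θ₁ θ₂ δ : ℝ}
    (h₁ : HasMajorantHom blkX blkY T₁ (fun a b => w a ^ γ * zoneK g N θ₁ δ a b))
    (h₂ : HasMajorantHom blkX blkY T₂ (fun a b => w a ^ γ * zoneK g N θ₂ δ a b)) :
    HasMajorantHom blkX blkY (T₁ - T₂) (fun a b => w a ^ γ * zoneK g N (θ₁ + θ₂) δ a b) :=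
  hasMajorantHom_mono blkX blkY (hom_sub blkX blkY h₁ h₂) fun a b => by
    rw [zoneK_apply, zoneK_apply, zoneK_apply]
    by_cases ha : a ∈ N
    · rw [if_pos ha, if_pos ha, if_pos ha]; ring_nf; rfl
    · rw [if_neg ha, if_neg ha, if_neg ha]; ring_nf; rfl

omit [DecidableEq g.Site] in
/-- weakening an `expK` majorant: larger constant, smaller rate (`d ≥ 0`, `w > 0`). [cite: Balaban1984PropagatorsII, (2.51) p.232] -/
theorem hom_weaken_exp (blkX : X → g.Site) (blkY : Y → g.Site) (hρ : IsPseudoDist g.dist) {T : (X → ℝ) →ₗ[ℝ] (Y → ℝ)}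
    {w : g.Site → ℝ} (hw : ∀ a, 0 < w a) {γ : ℤ} {c c' δ δ' : ℝ} (hc : 0 ≤ c) (hcc : c ≤ c') (hδ : δ' ≤ δ)
    (hT : HasMajorantHom blkX blkY T (fun a b => w a ^ γ * expK g c δ a b)) :
    HasMajorantHom blkX blkY T (fun a b => w a ^ γ * expK g c' δ' a b) :=
  hasMajorantHom_mono blkX blkY hT fun a b => mul_le_mul_of_nonneg_left (by
    rw [expK_apply, expK_apply]
    exact mul_le_mul hcc (Real.exp_le_exp.2 (by nlinarith [hρ.nonneg a b])) (Real.exp_pos _).le (hc.trans hcc))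
    (zpow_nonneg (hw a).le _)

/-- weakening a `zoneK` majorant. [cite: Balaban1984PropagatorsII, (2.51) p.232, p.238] -/
theorem hom_weaken_zone (blkX : X → g.Site) (blkY : Y → g.Site) (hρ : IsPseudoDist g.dist) {T : (X → ℝ) →ₗ[ℝ] (Y → ℝ)}
    {w : g.Site → ℝ} (hw : ∀ a, 0 < w a) {γ : ℤ} (N : Finset g.Site) {θ θ' δ δ' : ℝ} (hθ : 0 ≤ θ) (hθθ : θ ≤ θ') (hδ : δ' ≤ δ)
    (hT : HasMajorantHom blkX blkY T (fun a b => w a ^ γ * zoneK g N θ δ a b)) :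
    HasMajorantHom blkX blkY T (fun a b => w a ^ γ * zoneK g N θ' δ' a b) :=
  hasMajorantHom_mono blkX blkY hT fun a b => mul_le_mul_of_nonneg_left (by
    rw [zoneK_apply, zoneK_apply]
    by_cases ha : a ∈ N
    · rw [if_pos ha, if_pos ha]
      exact mul_le_mul hθθ (Real.exp_le_exp.2 (by nlinarith [hρ.nonneg a b])) (Real.exp_pos _).le (hθ.trans hθθ)
    · rw [if_neg ha, if_neg ha, zero_mul, zero_mul])
    (zpow_nonneg (hw a).le _)

omit [DecidableEq g.Site] in
/-- weakening a `shapeK` majorant. [cite: Balaban1984PropagatorsII, (2.51) p.232, p.238] -/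
theorem hom_weaken_shape (blkX : X → g.Site) (blkY : Y → g.Site) (hρ : IsPseudoDist g.dist) {β : g.Site → ℝ} (hβ : IsDepth g.dist β)
    {T : (X → ℝ) →ₗ[ℝ] (Y → ℝ)} {w : g.Site → ℝ} (hw : ∀ a, 0 < w a) {γ : ℤ} {ε ε' δ δ' : ℝ} (hε : 0 ≤ ε) (hεε : ε ≤ ε') (hδ : δ' ≤ δ)
    (hT : HasMajorantHom blkX blkY T (fun a b => w a ^ γ * shapeK g β ε δ a b)) :
    HasMajorantHom blkX blkY T (fun a b => w a ^ γ * shapeK g β ε' δ' a b) :=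
  hasMajorantHom_mono blkX blkY hT fun a b => mul_le_mul_of_nonneg_left (shapeK_mono hρ hβ hε hεε hδ a b) (zpow_nonneg (hw a).le _)

omit [DecidableEq g.Site] in
/-- **THE DEEP EVALUATION** (b06 `line3_deep_majorant`'s last step, kernel-generic): if `T` (one lattice) has the majorant `W(y)·shapeK(β, ε, r)(y, y′)` with
`W ≥ 0`, `ε ≥ 0`, `r ≥ 0`, and the cut-offs `ζ`, `h` (`|·| ≤ 1`) live on blocks of depth `≥ M₀` (`ζ(x) ≠ 0 ⇒ β(y(x)) ≥ M₀`, same for `h`), then `ζ·T·h` has the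
majorant `W(y)·(εe^{−rM₀}e^{−rM₀})·e^{−rd(y,y′)}` — *"an estimate has the factor e^{−δ₀M}"* (p. 238): both legs cross the depth `M₀`.
[cite: Balaban1984PropagatorsII, p.238 («an estimate has the factor e^{−δ₀M} because of the usual estimate of the type (1.12) [3] connected with a change of a domain»)] -/
theorem deep_eval_shape (blk : X → g.Site) {β : g.Site → ℝ}
    {T : Module.End ℝ (X → ℝ)} {W : g.Site → ℝ} (hW : ∀ a, 0 ≤ W a) {ε r M₀ : ℝ} (hε : 0 ≤ ε) (hr : 0 ≤ r)
    (hT : HasMajorant blk T (fun a b => W a * shapeK g β ε r a b)) {ζ h : X → ℝ} (hζ1 : ∀ x, |ζ x| ≤ 1) (hh1 : ∀ x, |h x| ≤ 1)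
    (hζdeep : ∀ x, ζ x ≠ 0 → M₀ ≤ β (blk x)) (hhdeep : ∀ x, h x ≠ 0 → M₀ ≤ β (blk x)) :
    HasMajorant blk (mulOp ζ * T * mulOp h)
      (fun a b => W a * (ε * Real.exp (-(r * M₀)) * Real.exp (-(r * M₀))) * Real.exp (-(r * g.dist a b))) := by
  intro y' μ B hμ x
  have hRHS : 0 ≤ W (blk x) * (ε * Real.exp (-(r * M₀)) * Real.exp (-(r * M₀))) * Real.exp (-(r * g.dist (blk x) y')) * B := by
    have := hμ.nonneg; have := hW (blk x); positivity
  have happ : (mulOp ζ * T * mulOp h) μ x = ζ x * (T (mulOp h μ)) x := by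
    simp only [Module.End.mul_apply, mulOp_apply]
  by_cases hx : ζ x = 0
  · rw [happ, hx, zero_mul, abs_zero]; exact hRHS
  by_cases hy : ∃ x', blk x' = y' ∧ h x' ≠ 0
  · obtain ⟨x', hx'b, hx'c⟩ := hy
    have ha : M₀ ≤ β (blk x) := hζdeep x hx
    have hb : M₀ ≤ β y' := by rw [← hx'b]; exact hhdeep x' hx'c
    have hμ' : BlockSupp blk (mulOp h μ) y' B := by
      refine ⟨hμ.nonneg, fun z hz => ?_, fun z hz => ?_⟩
      · rw [mulOp_apply, abs_mul]
        calc |h z| * |μ z| ≤ 1 * B := mul_le_mul (hh1 z) (hμ.bound z hz) (abs_nonneg _) zero_le_one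
          _ = B := one_mul B
      · rw [mulOp_apply, hμ.off z hz, mul_zero]
    have hmain := hT y' _ B hμ' x
    dsimp only at hmain ⊢
    rw [happ, abs_mul]
    refine le_trans (mul_le_mul (hζ1 x) hmain (abs_nonneg _) zero_le_one) ?_
    rw [one_mul]
    refine mul_le_mul_of_nonneg_right ?_ hμ.nonneg
    have hexp : Real.exp (-(r * (g.dist (blk x) y' + β (blk x) + β y'))) ≤
        Real.exp (-(r * M₀)) * Real.exp (-(r * M₀)) * Real.exp (-(r * g.dist (blk x) y')) := by
      rw [← Real.exp_add, ← Real.exp_add]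
      exact Real.exp_le_exp.2 (by nlinarith)
    rw [shapeK_apply]
    calc W (blk x) * (ε * Real.exp (-(r * (g.dist (blk x) y' + β (blk x) + β y'))))
        ≤ W (blk x) * (ε * (Real.exp (-(r * M₀)) * Real.exp (-(r * M₀)) * Real.exp (-(r * g.dist (blk x) y')))) :=
          mul_le_mul_of_nonneg_left (mul_le_mul_of_nonneg_left hexp hε) (hW _)
      _ = _ := by ring
  · have hzero : mulOp h μ = 0 := by
      funext x'
      rw [mulOp_apply, Pi.zero_apply]
      by_cases hb : blk x' = y'
      · have : h x' = 0 := by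
          by_contra hne
          exact hy ⟨x', hb, hne⟩
        rw [this, zero_mul]
      · rw [hμ.off x' hb, mul_zero]
    rw [happ, hzero, map_zero, Pi.zero_apply, mul_zero, abs_zero]
    exact hRHS

end Tools

end Literature.MathematicalPhysics.QuantumFieldTheory.Balaban1983to89.B6MajorantTransferSteps
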